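import Summits.Ventures.PercRepro.Night2LocalCovering

/-!
# PercRepro — one fractional matching for the full family certifies the local form (night-2, gen 8)

`localShadowHall_of_weights` asks for a fractional matching for EVERY sub-family `𝒜 ⊆ Uq`.  This file records the
re-framing of `proofs/NIGHT-2-local.md` §17(a): ONE matching for the full family `Uq M (q+2) q`, supported on
containment (`w B S ≠ 0 → B ⊆ S`), with column sums `≤ 1` on the shadow of the full family and row sums dominating
the local demands, certifies `LocalShadowHall M q G` (**`localShadowHall_of_full_matching`**).  Restricting the
matching to a sub-family only lowers the column sums, and the row sum of a member `B ∈ 𝒜` is unchanged: every set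
`S ⊇ B` with closure `G` in the shadow of the full family is in the shadow of `𝒜` (`mem_shadowAt_of_subset`).

So a rule `w(B, S)` may depend on `M` and `G` in any way (the numbers of covering preimages `κ(S)`, the layer-0
count `k₁(S)`, …); only a dependence on the sub-family is excluded.  This is the plug for the three-layer rule of
§17(c): its open Lemma B is exactly the row condition below for `w = w₀ + w₁ + w₂`.
-/

namespace PercRepro.Shadow

open Finset PerFlat ThmH

variable {α : Type*} [DecidableEq α] {M : Matroid α} [M.Finite]

open scoped Classical in
/-- A shadow set of a larger family containing a member of `𝒜` is a shadow set of `𝒜`. -/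
theorem mem_shadowAt_of_subset {p q : ℕ} {𝒜 𝒜' : Finset (Finset α)} {G S B : Finset α}
    (hS : S ∈ shadowAt M p q 𝒜' G) (hB : B ∈ 𝒜) (hBS : B ⊆ S) : S ∈ shadowAt M p q 𝒜 G := by
  rw [mem_shadowAt, mem_shadow] at hS ⊢
  exact ⟨⟨hS.1.1, B, hB, hBS⟩, hS.2⟩

open scoped Classical in
/-- **One matching for the full family certifies the local form.** -/
theorem localShadowHall_of_full_matching {q : ℕ} {G : Finset α} (w : Finset α → Finset α → ℚ)
    (hnn : ∀ B S, 0 ≤ w B S) (hsupp : ∀ B S, w B S ≠ 0 → B ⊆ S)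
    (hcol : ∀ S ∈ shadowAt M (q + 2) q (Uq M (q + 2) q) G,
      ∑ B ∈ membersIn M (Uq M (q + 2) q) G, w B S ≤ 1)
    (hrow : ∀ B ∈ membersIn M (Uq M (q + 2) q) G,
      (((q : ℚ) + 2) / ((q : ℚ) + 1)) * localWeight M B G ≤
        ∑ S ∈ shadowAt M (q + 2) q (Uq M (q + 2) q) G, w B S) :
    LocalShadowHall M q G := by
  apply localShadowHall_of_weights
  intro 𝒜 h𝒜
  refine ⟨w, hnn, ?_, ?_⟩
  · intro S hS
    calc ∑ B ∈ membersIn M 𝒜 G, w B S ≤ ∑ B ∈ membersIn M (Uq M (q + 2) q) G, w B S :=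
          Finset.sum_le_sum_of_subset_of_nonneg (membersIn_mono h𝒜 G) (fun B _ _ => hnn B S)
      _ ≤ 1 := hcol S (shadowAt_mono h𝒜 G hS)
  · intro B hB
    have hB' : B ∈ membersIn M (Uq M (q + 2) q) G := membersIn_mono h𝒜 G hB
    have hB𝒜 : B ∈ 𝒜 := (mem_membersIn.1 hB).1
    have heq : ∑ S ∈ shadowAt M (q + 2) q 𝒜 G, w B S =
        ∑ S ∈ shadowAt M (q + 2) q (Uq M (q + 2) q) G, w B S := by
      apply Finset.sum_subset (shadowAt_mono h𝒜 G)
      intro S hS hS𝒜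
      by_contra hne
      exact hS𝒜 (mem_shadowAt_of_subset hS hB𝒜 (hsupp B S hne))
    rw [heq]
    exact hrow B hB'

end PercRepro.Shadow
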